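import Literature.AnabelianGeometry.AbsoluteAnabelian.AbsTopIII.FunctionFieldSlimProofs
import Literature.AnabelianGeometry.AbsoluteAnabelian.SubpadicSlimProofs
import Literature.AnabelianGeometry.AbsoluteAnabelian.SubpadicExamples
import HarnessLib

/-!
# [AbsTopIII] Theorem 1.11, slimness — the sub-`p`-adic case, fully proved (erratum-aware form)

S. Mochizuki, *Topics in absolute anabelian geometry III*, Theorem 1.11 (p. 45): for the function
field `K = K_X` of a curve over a Kummer-faithful field `k`, "`Δ_{η_X}`, `Π_{η_X}`, and `G_k` are
slim".  The cell records this as the three-conjunct closed fact `AbsTopIII.Thm_1_11_slim`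
(`BirationalReconstruction.lean`, typed faithfully to print).

ERRATUM (published): T. Asayama, *Kummer-faithful fields with finitely generated absolute Galois
group*, arXiv:2601.10298 (2026), Cor. 1.5 / Cor. 4.1: "There exists an algebraic extension of `K`
[a number field] that is Kummer-faithful and has abelian absolute Galois group", and Rmk. 1.6:
"One of the assertions in Theorem 1.11 of Mochizuki's paper [...] claimed that the absolute Galois
group of any Kummer-faithful field of characteristic zero is slim [...]. He recently informed us
that the proof of this assertion has a gap. Corollary 1.5 is incompatible with this assertion and
shows the existence of a counterexample in the general case, but the proof is not constructive."
Hence the third conjunct of `Thm_1_11_slim` ("`G_k` slim" for an ARBITRARY Kummer-faithful `k`) is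
false in general, and the closed fact `Thm_1_11_slim` must not be consumed as an admissible
hypothesis.  (No kernel refutation is offered here: the counterexample is a Haar-measure existence
argument over `G_K`, `K` a number field.)

WHAT IS TRUE AND PROVED HERE (no hypothesis beyond the binders of the fact): the statement of
`Thm_1_11_slim` with "Kummer-faithful" replaced by "sub-`p`-adic" — the case that the printed
proof's own reference for the slimness of `G_k` ([pGC] = [Mzk5] Lemma 15.8, p. 47: "the slimness of
`G_k` follows immediately from the argument applied in [Mzk5], Lemma 15.8, to verify the slimness of
`G_k` when `k` is sub-`p`-adic") actually establishes, and the only case [IUTchI–IV] use (`k` an MLF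
or an NF).  All three conjuncts are already kernel theorems of the tree; this file assembles them:

* (a) `Π_{η_X} = Gal(K̄/K)` slim — `isSlimGroup_absoluteGaloisGroup_of_isAlgFunctionField`
  (file `FunctionFieldSlimProofs`; needs only `k` torally Kummer-faithful, which sub-`p`-adic fields
  are: `IsSubpadic.isTorallyKummerFaithful` = [AbsTopIII] Rmk. 1.5.4 (i), torus half);
* (b) `Δ_{η_X}` slim — `isSlimGroup_geom_genericPointExtension` (file
  `FunctionFieldGeometricSlimProofs`; every `k` of characteristic zero);
* (c) `G_k` slim — `IsSubpadicFor.isSlimGroup_absoluteGaloisGroup` = [pGC] Lem. 15.8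
  (`pGC.lem_15_8_slim_holds`, file `SubpadicSlimProofs`).

Results: `Thm_1_11_slim_subpadic` (the repaired three-conjunct statement), and the instances
`Thm_1_11_slim_of_isMLF`, `Thm_1_11_slim_of_isNF` for the base fields of [IUTchI–IV].  (For a
generalized sub-`p`-adic `k`, conjunct (c) is `Tpcs.lem_4_14_slim_holds`; conjunct (a) would need the
closure of that class under finitely generated extensions, not assembled here.)

HONEST FRAMING: classical statements about Galois groups of function fields over sub-`p`-adic
fields, kernel-checked; the erratum concerns a prerequisite paper ([AbsTopIII]), is reported with
its locator, and nothing here bears on [IUTchIII] Cor. 3.12.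
[cite: MochizukiAbsTopIII2015, Thm 1.11 pp.45–47] [cite: MochizukiLocAn1999, Lem 15.8 p.80]
[cite: Asayama2026KummerFaithfulFG, Rmk 1.6 / Cor 1.5]
-/

noncomputable section

open scoped Classical

namespace Literature.AnabelianGeometry.AbsoluteAnabelian.AbsTopIII

open Field
open Literature.NumberTheory.GaloisRepresentations (absGaloisRestrict)
open Literature.NumberTheory.DiophantineGeometry
open Literature.AlgebraicGeometry.Frobenioids (IsSlimGroup)

universe u

/-- **[AbsTopIII] Theorem 1.11, slimness, over a sub-`p`-adic base field — PROVED.**  For an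
algebraic function field of one variable `K/k` (`k` of characteristic zero, algebraically closed in
`K`, `Gal(K̄/K) → Gal(k̄/k)` surjective) with `k` sub-`p`-adic: `Π_{η_X} = Gal(K̄/K)`,
`Δ_{η_X} = Ker(Gal(K̄/K) → Gal(k̄/k))` and `G_k = Gal(k̄/k)` are slim.  This is the statement of the
closed fact `Thm_1_11_slim` with its hypothesis "Kummer-faithful" strengthened to "sub-`p`-adic";
the printed statement for arbitrary Kummer-faithful `k` is false in general (Asayama 2026,
arXiv:2601.10298, Rmk. 1.6 / Cor. 1.5 — see the module docstring), while the sub-`p`-adic case is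
exactly what the printed proof's reference [pGC] Lem. 15.8 gives.  The hypotheses `[CharZero K]`,
`[IsIntegrallyClosedIn k K]` are carried only to mirror the binders of `Thm_1_11_slim`.
[cite: MochizukiAbsTopIII2015, Thm 1.11 p.45] [cite: MochizukiLocAn1999, Lem 15.8 p.80]
[cite: Asayama2026KummerFaithfulFG, Rmk 1.6] -/
theorem Thm_1_11_slim_subpadic (k K : Type u) [Field k] [CharZero k] [Field K] [CharZero K]
    [Algebra k K] [IsAlgFunctionField k K] [IsIntegrallyClosedIn k K]
    (hsurj : Function.Surjective (absGaloisRestrict k K)) (hk : IsSubpadic k) :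
    IsSlimGroup (Field.absoluteGaloisGroup K)
      ∧ IsSlimGroup (genericPointExtension k K hsurj).geom
      ∧ IsSlimGroup (Field.absoluteGaloisGroup k) := by
  obtain ⟨p, hp, hkp⟩ := hk.exists_prime
  exact ⟨isSlimGroup_absoluteGaloisGroup_of_isAlgFunctionField k K hk.isTorallyKummerFaithful,
    isSlimGroup_geom_genericPointExtension k K hsurj,
    IsSubpadicFor.isSlimGroup_absoluteGaloisGroup hkp⟩

/-- **[AbsTopIII] Theorem 1.11, slimness, over an MLF — PROVED** (the local base fields of
[IUTchI–IV]): an MLF is sub-`p`-adic (`IsSubpadic.of_isMLF`, [pGC] Def. 15.4 (i) example (1)).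
[cite: MochizukiAbsTopIII2015, Thm 1.11 p.45] [cite: MochizukiLocAn1999, Def 15.4 (i) p.77] -/
theorem Thm_1_11_slim_of_isMLF (k K : Type u) [Field k] [CharZero k] [Field K] [CharZero K]
    [Algebra k K] [IsAlgFunctionField k K] [IsIntegrallyClosedIn k K]
    (hsurj : Function.Surjective (absGaloisRestrict k K)) (hk : IsMLF k) :
    IsSlimGroup (Field.absoluteGaloisGroup K)
      ∧ IsSlimGroup (genericPointExtension k K hsurj).geom
      ∧ IsSlimGroup (Field.absoluteGaloisGroup k) :=
  Thm_1_11_slim_subpadic k K hsurj (IsSubpadic.of_isMLF hk)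

/-- **[AbsTopIII] Theorem 1.11, slimness, over a number field — PROVED** (the global base fields
of [IUTchI–IV]): a number field is sub-`p`-adic (`IsSubpadic.of_isNF`, [pGC] Def. 15.4 (i)
example (2)). [cite: MochizukiAbsTopIII2015, Thm 1.11 p.45] [cite: MochizukiLocAn1999, Def 15.4 (i) p.77] -/
theorem Thm_1_11_slim_of_isNF (k K : Type u) [Field k] [CharZero k] [Field K] [CharZero K]
    [Algebra k K] [IsAlgFunctionField k K] [IsIntegrallyClosedIn k K]
    (hsurj : Function.Surjective (absGaloisRestrict k K)) (hk : IsNF k) :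
    IsSlimGroup (Field.absoluteGaloisGroup K)
      ∧ IsSlimGroup (genericPointExtension k K hsurj).geom
      ∧ IsSlimGroup (Field.absoluteGaloisGroup k) :=
  Thm_1_11_slim_subpadic k K hsurj (IsSubpadic.of_isNF hk)

/-- **The fact `Thm_1_11_slim` restricted to sub-`p`-adic base fields holds**: every instance of
the closed fact `Thm_1_11_slim` whose base field is (Kummer-faithful AND) sub-`p`-adic is a theorem —
stated as the implication from the extra hypothesis, so that a consumer holding `IsSubpadic k` never
needs the (erroneous, in general) closed fact. [cite: MochizukiAbsTopIII2015, Thm 1.11 p.45] -/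
theorem Thm_1_11_slim_instance_of_isSubpadic (k K : Type u) [Field k] [CharZero k] [Field K]
    [CharZero K] [Algebra k K] [IsAlgFunctionField k K] [IsIntegrallyClosedIn k K]
    (hsurj : Function.Surjective (absGaloisRestrict k K)) (_hKF : IsKummerFaithful k)
    (hk : IsSubpadic k) :
    IsSlimGroup (Field.absoluteGaloisGroup K)
      ∧ IsSlimGroup (genericPointExtension k K hsurj).geom
      ∧ IsSlimGroup (Field.absoluteGaloisGroup k) :=
  Thm_1_11_slim_subpadic k K hsurj hk

end Literature.AnabelianGeometry.AbsoluteAnabelian.AbsTopIII
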